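import Mathlib
import Summits.ValiantsHypothesis.ValiantsHypothesis.Statement
import Summits.ValiantsHypothesis.ValiantsHypothesis.Theorems.SoloInformedBilinearGirth
import Summits.ValiantsHypothesis.ValiantsHypothesis.Theorems.SoloInformedAsymSumsetGirth
import HarnessLib

/-!
# Soloist (informed) rung: the bundle girth bound — the partner half of `n → s` (quadspan 2.60)

Session s34 of the soloist programme `solo-ValiantsHypothesis-informed`.

`soloInformed_bilinearGirth` (Cor. 7.18, s33) bounds a `(K,h)`-free set `E` of exponents realised
as monomial `2 × 2` minors of `L` nonzero polynomial columns by `N + 86k N^{1+1/k}`,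
`N = L(⌊log₂ L⌋+1)` — super-linear in the NUMBER OF VECTORS `L`.  Here the super-linear term is
moved onto the set `V` of column ORDERS, and `|V| ≤ dim W` whenever the entries lie in a space `W`
(nonzero polynomials with distinct orders are linearly independent), uniformly in `L`:

* `soloInformed_bundleGirth` — nonzero columns `(p i, q i)`, `i < L`, with orders in `V ⊂ ℕ`,
  `E` realised by monomial minors, `(K,h)`-free, `4k ≤ K`:
  `|E| ≤ L⌊log₂ L⌋ + 86 k |V|^{1+1/k}`.  Proof: the owner/level bookkeeping of
  `SoloInformedBilinearGirth` (Cramer ultrametric + halving: at most `L⌊log₂ L⌋` bundles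
  `(o, θ)`) writes every target as `e = (μ_o + θ) + μ_partner` with `μ_partner ∈ V`; apply
  `soloInformed_asymSumsetGirth` with first summand the bundle value `μ_o + θ`.
* `solo_card_le_finrank_of_orders` — if for every `a ∈ V` the space `W` contains a nonzero
  polynomial of order exactly `a`, then `|V| ≤ dim W` (echelon argument on lowest coefficients).
* `soloInformed_bundleGirth_finrank` — the same bound with `|V|` replaced by `dim W` for columns
  with entries in `W`:  `|E| ≤ L⌊log₂ L⌋ + 86 k (dim W)^{1+1/k}`.

PATH TO THE SUMMIT.  In the rank-2 case of the hypothesis `hQ` of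
`soloInformed_valiantsHypothesis_of_unipolyLogOrderBound` (`s` generators `b_j`, columns
`u = (b_i, b_j)`, so `L ≤ s²`, entries in `W = span b`, `dim W ≤ s`) the last theorem gives
`|E| ≤ L⌊log₂ L⌋ + 86k s^{1+1/k}`: the PARTNER side of the vector-proliferation obstruction
(quadspan Remark 7.19) is discharged by dimension.  What remains there is OWNER PROLIFERATION
(VB″): bound the number of bundles `(o, θ)` that carry a target by `C s^{3/2-δ}` — the term
`L⌊log₂ L⌋` above counts them by vectors, which is useless when `L ≫ s^{3/2}`.  Nothing in this
file addresses (VB″).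

References: Bondy–Simonovits, JCTB 16 (1974) 97–105 (Literature `BondySimonovits1974`); soloist
notes `paper/quadspan.md` 2.59–2.61, `paper/sharpest.md` §9.12–9.13.
-/

namespace Summit.ValiantsHypothesis.ValiantsHypothesis.Theorems

open Finset Polynomial

/-- **Bundle girth bound** (quadspan Theorem 2.60, kernel form).  Let `u_i = (p i, q i)`,
`i < L`, be nonzero columns of polynomials over a field whose orders at `0` all lie in `V ⊂ ℕ`,
and let every `X^e`, `e ∈ E`, be a nonzero scalar multiple of a minor `p_i q_j - p_j q_i`.  If
`E` is `(K,h)`-free with `4k ≤ K`, `1 ≤ k`, `1 ≤ h`, then `|E| ≤ L⌊log₂ L⌋ + 86 k |V|^{1 + 1/k}`: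
the super-linear term of `soloInformed_bilinearGirth` is moved from the number `L` of vectors
onto `|V|`.  (OPEN: bound the first term by the dimension of the span of the entries — owner
proliferation, (VB″).) -/
theorem soloInformed_bundleGirth {F : Type*} [Field F] {L K h k : ℕ}
    (hk : 1 ≤ k) (hK : 4 * k ≤ K) (hh : 1 ≤ h)
    (p q : Fin L → F[X]) (hcol : ∀ i, p i ≠ 0 ∨ q i ≠ 0)
    (V : Finset ℕ) (hV : ∀ i, soloBGm p q i ∈ V) (E : Finset ℕ)
    (hE : ∀ e ∈ E, ∃ i j : Fin L, ∃ c : F, c ≠ 0 ∧ p i * q j - p j * q i = C c * X ^ e)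
    (hfree : SoloNatFree K h E) :
    (E.card : ℝ) ≤ (L * Nat.log 2 L : ℕ) + 86 * k * (V.card : ℝ) ^ (1 + 1 / (k : ℝ)) := by
  classical
  rcases Nat.eq_zero_or_pos L with hL | hL
  · subst hL
    have hE0 : E = ∅ := by
      rw [← subset_empty]
      intro e he
      obtain ⟨i, -, -, -, -⟩ := hE e he
      exact i.elim0
    subst hE0
    simp only [card_empty, Nat.cast_zero]
    positivity
  haveI : Inhabited (Fin L) := ⟨⟨0, hL⟩⟩
  choose! wi wj wc hwc hdet using hE
  have hd : ∀ e ∈ E, soloBGd p q (wi e) (wj e) = (e : ℕ∞) := by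
    intro e he
    simp only [soloBGd, soloBGdet, hdet e he]
    exact trailingDegree_C_mul_X_pow e (hwc e he)
  have hle : ∀ e ∈ E, soloBGm p q (wi e) + soloBGm p q (wj e) ≤ e := by
    intro e he
    have h := solo_bg_mu_add_le_d p q (wi e) (wj e)
    rw [hd e he, ← solo_bg_m_coe (hcol (wi e)), ← solo_bg_m_coe (hcol (wj e))] at h
    exact_mod_cast h
  set θf : ℕ → ℕ := fun e => e - (soloBGm p q (wi e) + soloBGm p q (wj e)) with hθf
  have hθe : ∀ e ∈ E, e = θf e + soloBGm p q (wi e) + soloBGm p q (wj e) := by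
    intro e he; have := hle e he; simp only [hθf]; omega
  have hdθ : ∀ e ∈ E, soloBGd p q (wi e) (wj e) =
      ((θf e + soloBGm p q (wi e) + soloBGm p q (wj e) : ℕ) : ℕ∞) := by
    intro e he; rw [hd e he]; exact_mod_cast hθe e he
  -- the owner of a target: the endpoint whose class at level `θ + 1` is smaller
  set own : ℕ → Fin L := fun e =>
    if (soloBGcl p q (wi e) (θf e + 1)).card ≤ (soloBGcl p q (wj e) (θf e + 1)).card
    then wi e else wj e with hown
  set oth : ℕ → Fin L := fun e =>
    if (soloBGcl p q (wi e) (θf e + 1)).card ≤ (soloBGcl p q (wj e) (θf e + 1)).card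
    then wj e else wi e with hoth
  have hsum : ∀ e ∈ E, e = θf e + soloBGm p q (own e) + soloBGm p q (oth e) := by
    intro e he
    have := hθe e he
    simp only [hown, hoth]
    split_ifs with hc
    · exact this
    · omega
  have hhalf : ∀ e ∈ E,
      2 * (soloBGcl p q (own e) (θf e + 1)).card ≤ (soloBGcl p q (own e) (θf e)).card := by
    intro e he
    obtain ⟨hsplit, heq⟩ := solo_bg_split hcol (hdθ e he)
    simp only [hown]
    split_ifs with hc
    · omega
    · rw [heq]; omega
  -- halving: each owner has at most `⌊log₂ L⌋` levels, so at most `L⌊log₂ L⌋` bundles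
  set S : Fin L → Finset ℕ := fun i => (E.filter fun e => own e = i).image θf with hS
  have hScard : ∀ i, (S i).card ≤ Nat.log 2 L := by
    intro i
    apply Nat.le_log_of_pow_le one_lt_two
    refine solo_halving_chain (S i) (fun θ => (soloBGcl p q i (θ + 1)).card) L hL ?_ ?_ ?_
    · intro θ _
      exact Finset.card_pos.mpr ⟨i, solo_bg_self_mem_cl i (θ + 1)⟩
    · intro θ hθ
      simp only [hS, mem_image, mem_filter] at hθ
      obtain ⟨e, ⟨he, hoe⟩, rfl⟩ := hθ
      have h1 := hhalf e he
      rw [hoe] at h1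
      exact h1.trans (solo_bg_card_cl_le _ _)
    · intro θ hθ θ' hθ' hlt
      simp only [hS, mem_image, mem_filter] at hθ'
      obtain ⟨e', ⟨he', hoe'⟩, rfl⟩ := hθ'
      have h1 := hhalf e' he'
      rw [hoe'] at h1
      exact h1.trans (card_le_card (solo_bg_cl_antitone i (by omega)))
  set Bun : Finset (Fin L × ℕ) := E.image fun e => (own e, θf e) with hBun
  have hBun_card : Bun.card ≤ L * Nat.log 2 L := by
    have hsub : Bun ⊆ (univ : Finset (Fin L)).biUnion fun i => (S i).image (Prod.mk i) := by
      intro b hb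
      simp only [hBun, mem_image] at hb
      obtain ⟨e, he, rfl⟩ := hb
      rw [mem_biUnion]
      refine ⟨own e, mem_univ _, ?_⟩
      rw [mem_image]
      refine ⟨θf e, ?_, rfl⟩
      simp only [hS, mem_image, mem_filter]
      exact ⟨e, ⟨he, rfl⟩, rfl⟩
    calc Bun.card ≤ ((univ : Finset (Fin L)).biUnion fun i => (S i).image (Prod.mk i)).card :=
          card_le_card hsub
      _ ≤ ∑ i : Fin L, ((S i).image (Prod.mk i)).card := card_biUnion_le
      _ ≤ ∑ i : Fin L, Nat.log 2 L :=
          sum_le_sum fun i _ => card_image_le.trans (hScard i)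
      _ = L * Nat.log 2 L := by simp
  -- the bundle VALUE `μ_o + θ` and the partner order: `e = x e + v e` with `v e ∈ V`
  set x : ℕ → ℕ := fun e => soloBGm p q (own e) + θf e with hx
  set v : ℕ → ℕ := fun e => soloBGm p q (oth e) with hv
  have hxv : ∀ e ∈ E, x e + v e = e := by
    intro e he; have := hsum e he; simp only [hx, hv]; omega
  have hvV : ∀ e ∈ E, v e ∈ V := fun e _ => hV (oth e)
  have hX : (E.image x).card ≤ L * Nat.log 2 L := by
    have hsub : E.image x ⊆ Bun.image fun b => soloBGm p q b.1 + b.2 := by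
      intro a ha
      rw [mem_image] at ha
      obtain ⟨e, he, rfl⟩ := ha
      rw [mem_image]
      exact ⟨(own e, θf e), by rw [hBun, mem_image]; exact ⟨e, he, rfl⟩, rfl⟩
    exact (card_le_card hsub).trans (card_image_le.trans hBun_card)
  have hmain := soloInformed_asymSumsetGirth hk hK hh E V x v hvV hxv hfree
  have hXr : ((E.image x).card : ℝ) ≤ ((L * Nat.log 2 L : ℕ) : ℝ) := by exact_mod_cast hX
  linarith

/-- Echelon bound: if a subspace `W` of `F[X]` contains, for every `a ∈ V`, a nonzero polynomial
of order (trailing degree) exactly `a`, then `|V| ≤ dim W` — nonzero polynomials with pairwise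
distinct orders are linearly independent (look at the lowest coefficient). -/
theorem solo_card_le_finrank_of_orders {F : Type*} [Field F] (W : Submodule F F[X])
    [FiniteDimensional F W] (V : Finset ℕ)
    (hV : ∀ a ∈ V, ∃ f ∈ W, f ≠ 0 ∧ f.natTrailingDegree = a) :
    V.card ≤ Module.finrank F W := by
  classical
  choose! f hfW hf0 hfd using hV
  -- the family `a ↦ f a`, `a ∈ V`, is linearly independent in `F[X]`
  have hli : LinearIndependent F (fun a : ↥V => f (a : ℕ)) := by
    rw [linearIndependent_iff']
    intro s g hsum
    by_contra hne
    push Not at hne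
    obtain ⟨a₀, ha₀s, hga₀⟩ := hne
    set T := s.filter fun a => g a ≠ 0 with hT
    have hTne : T.Nonempty := ⟨a₀, mem_filter.mpr ⟨ha₀s, hga₀⟩⟩
    obtain ⟨m, hmT, hmin⟩ := T.exists_min_image (fun a : ↥V => (a : ℕ)) hTne
    have hgm : g m ≠ 0 := (mem_filter.mp hmT).2
    have hcoef := congrArg (fun P : F[X] => P.coeff (m : ℕ)) hsum
    simp only [finsetSum_coeff, coeff_smul, coeff_zero, smul_eq_mul] at hcoef
    rw [sum_eq_single m] at hcoef
    · have hc : (f (m : ℕ)).coeff (f (m : ℕ)).natTrailingDegree ≠ 0 :=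
        mt trailingCoeff_eq_zero.mp (hf0 m m.2)
      rw [hfd m m.2] at hc
      exact hgm ((mul_eq_zero.mp hcoef).resolve_right hc)
    · intro a has ham
      by_cases hga : g a = 0
      · rw [hga, zero_mul]
      · have hle := hmin a (mem_filter.mpr ⟨has, hga⟩)
        have hlt : (m : ℕ) < (f (a : ℕ)).natTrailingDegree := by
          rw [hfd a a.2]
          exact lt_of_le_of_ne hle fun h => ham (Subtype.ext h).symm
        rw [coeff_eq_zero_of_lt_natTrailingDegree hlt, mul_zero]
    · intro hm
      exact absurd (mem_filter.mp hmT).1 hm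
  -- hence independent in `W`, and `|V| ≤ dim W`
  have hli' : LinearIndependent F (fun a : ↥V => (⟨f (a : ℕ), hfW a a.2⟩ : ↥W)) :=
    LinearIndependent.of_comp W.subtype (by exact hli)
  have h := hli'.fintype_card_le_finrank
  rwa [Fintype.card_coe] at h

/-- **Bundle girth bound, dimension form** (quadspan 2.60).  For nonzero columns
`u_i = (p i, q i)`, `i < L`, with all entries in a finite-dimensional subspace `W ⊂ F[X]`, and
`E` a `(K,h)`-free set of exponents `e` with `X^e` a nonzero multiple of a minor
`p_i q_j - p_j q_i` (`4k ≤ K`, `1 ≤ k`, `1 ≤ h`):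
`|E| ≤ L⌊log₂ L⌋ + 86 k (dim W)^{1 + 1/k}`.  The super-linear term depends on the dimension
only, not on the number of vectors. -/
theorem soloInformed_bundleGirth_finrank {F : Type*} [Field F] {L K h k : ℕ}
    (hk : 1 ≤ k) (hK : 4 * k ≤ K) (hh : 1 ≤ h) (W : Submodule F F[X]) [FiniteDimensional F W]
    (p q : Fin L → F[X]) (hpW : ∀ i, p i ∈ W) (hqW : ∀ i, q i ∈ W)
    (hcol : ∀ i, p i ≠ 0 ∨ q i ≠ 0) (E : Finset ℕ)
    (hE : ∀ e ∈ E, ∃ i j : Fin L, ∃ c : F, c ≠ 0 ∧ p i * q j - p j * q i = C c * X ^ e)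
    (hfree : SoloNatFree K h E) :
    (E.card : ℝ) ≤ (L * Nat.log 2 L : ℕ) +
      86 * k * (Module.finrank F W : ℝ) ^ (1 + 1 / (k : ℝ)) := by
  classical
  set V : Finset ℕ := (univ : Finset (Fin L)).image (soloBGm p q) with hVdef
  have hV : ∀ i, soloBGm p q i ∈ V := fun i => mem_image_of_mem _ (mem_univ i)
  have h1 := soloInformed_bundleGirth hk hK hh p q hcol V hV E hE hfree
  -- every order in `V` is the order of a nonzero entry, which lies in `W`
  have hrep : ∀ a ∈ V, ∃ f ∈ W, f ≠ 0 ∧ f.natTrailingDegree = a := by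
    intro a ha
    rw [hVdef, mem_image] at ha
    obtain ⟨i, -, rfl⟩ := ha
    set f : F[X] := if (p i).trailingDegree ≤ (q i).trailingDegree then p i else q i with hf
    have hfW : f ∈ W := by simp only [hf]; split_ifs <;> simp [hpW, hqW]
    have hμ : f.trailingDegree = soloBGmu p q i := by
      simp only [hf, soloBGmu]
      split_ifs with hc
      · exact (min_eq_left hc).symm
      · exact (min_eq_right (le_of_not_ge hc)).symm
    have hf0 : f ≠ 0 := fun h0 =>
      solo_bg_mu_ne_top (hcol i) (hμ.symm.trans (trailingDegree_eq_top.mpr h0))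
    refine ⟨f, hfW, hf0, ?_⟩
    have h2 : (f.natTrailingDegree : ℕ∞) = (soloBGm p q i : ℕ∞) := by
      rw [← trailingDegree_eq_natTrailingDegree hf0, hμ, solo_bg_m_coe (hcol i)]
    exact_mod_cast h2
  have hcard : V.card ≤ Module.finrank F W := solo_card_le_finrank_of_orders W V hrep
  have hpow : (V.card : ℝ) ^ (1 + 1 / (k : ℝ)) ≤ (Module.finrank F W : ℝ) ^ (1 + 1 / (k : ℝ)) :=
    Real.rpow_le_rpow (by positivity) (by exact_mod_cast hcard) (by positivity)
  have hk0 : (0 : ℝ) ≤ 86 * k := by positivity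
  nlinarith [mul_le_mul_of_nonneg_left hpow hk0]

end Summit.ValiantsHypothesis.ValiantsHypothesis.Theorems
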